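import Literature.AlgebraicGeometry.Motives.RuledSurfaceRelation
import Literature.AlgebraicGeometry.Motives.ProjectiveSpaceFieldPointsBijective
import Literature.AlgebraicGeometry.Motives.CyclesBirationalLiftProofs
import Literature.AlgebraicGeometry.Motives.BlowupTwoGeneratorsResidueField
import Literature.AlgebraicGeometry.Motives.LinesGenerateChowOneProofs
import Literature.RingTheory.MvPolynomial.VanishingOnSubspace
import Literature.RingTheory.MvPolynomial.TwoPointLineChains
import Literature.FieldTheory.QuasiAlgClosed.TsenSystems
import Literature.AlgebraicGeometry.Resolution.NormalizationOfVarietiesProofs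
import Literature.AlgebraicGeometry.Resolution.SurfaceResolutionReduction
import Literature.AlgebraicGeometry.Resolution.QuadraticTransformsUFD
import Literature.AlgebraicGeometry.Motives.CyclesDimensionFunctionField
import HarnessLib

/-!
# Lines generate `CH₁` of a smooth complete intersection with `Σ dᵢ² ≤ n + c` (Tian–Zong, Prop. 7.2)

The "product trick" proof of Tian–Zong, *One-cycles on rationally connected varieties*
(Compositio Math. 150 (2014)), Prop. 7.2, formalized for smooth complete intersections
`X = V₊(F₁, …, F_c) ⊆ ℙᴺ_k` (`N = n + c`) of multidegree `d` with `Σ d_a² ≤ N` over an algebraically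
closed field `k`: **every curve class on `X` is an integral combination of classes of lines**.

Proof (Tian–Zong, proof of Prop. 7.2, p. 10). Let `C ⊆ X` be an integral curve, `B → C` its
normalization, `K = k(B)` (`trdeg_k K = 1`). The generic point of `C` is a `K`-point `γ` of the
generic fibre `X_K`; fix a closed point `x₀ ∈ X(k) ⊆ X(K)`. By Tsen's theorem (`K` is `C₁`,
`Literature.FieldTheory.QuasiAlgClosed.TsenSystems`) and `Σ d_a² ≤ N` there is a `K`-point `r` of
`X_K` such that the lines `γ r` and `x₀ r` lie in `X_K`
(`Literature.RingTheory.MvPolynomial.TwoPointLineChains`). The closure in `X ×ₖ B` of such a line is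
a surface ruled over `B` on which the two sections are rationally equivalent modulo vertical
components, all of which are lines (`ProjFamily.exists_relation_of_two_points_on_line`,
`Motives/RuledSurfaceRelation`). Pushing forward along the proper projection `X ×ₖ B → X`
(Fulton, Thm. 1.4), the section `γ̄ ≅ B` maps birationally onto `C`, the section through `r`
cancels between the two relations, and the constant section `x₀ × B` is contracted; hence
`[C] ∈ Σ ℤ·[lines] + Rat₁(X)`.

Main results: `ProjFamily.exists_lines_of_birational_curve` (the relation `[C] ~ Σ nᵢ [ℓᵢ]` for a
curve dominated birationally by a smooth proper curve `B`, the form in which the normalization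
enters), the normalization `B = C^ν → C ⊆ X` of an integral curve with the properties needed there
(`ProjFamily.curveB`, `curveν`, `curveA`: proper, dimension one, principal local rings,
`trdeg_k k(B) = 1`, birational onto `C` — from `Resolution/NormalizationOfVarieties`,
`Resolution/SurfaceResolutionReduction`), and the case `Σ d_a² ≤ n + c` of the named fact
`TianZong2014_chowOne_generatedByLines`: `TianZong2014_chowOne_generatedByLines_of_sum_sq_le`.

## References

* [TianZong2014] Z. Tian, H. R. Zong, *One-cycles on rationally connected varieties*, Compositio
  Math. 150 (2014), Prop. 7.2 and its proof; Thm. 1.7.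
* [Fulton1998] W. Fulton, *Intersection Theory*, Thm. 1.4, §1.4, §10.1.
* [Pfister1995] A. Pfister, *Quadratic Forms with Applications to Algebraic Geometry and
  Topology*, Ch. 5 (Tsen's theorem).
* [Liu2002] Q. Liu, *Algebraic Geometry and Arithmetic Curves*, Def. 4.1.24, Cor. 4.1.30
  (normalization of an integral variety is finite).
* [DeJong1996] A. J. de Jong, *Smoothness, semi-stability and alterations*, 4.3 (the
  normalization of a curve is regular).
* [GortzWedhorn2020] U. Görtz, T. Wedhorn, *Algebraic Geometry I*, Thm. 5.22 (3)
  (`dim = trdeg`).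
-/

noncomputable section

open CategoryTheory CategoryTheory.Limits AlgebraicGeometry MonoidalCategory MvPolynomial
  TopologicalSpace Order

universe u

namespace Literature.AlgebraicGeometry.Motives

attribute [local instance] MvPolynomial.gradedAlgebra MvPolynomial.algebraMvPolynomial
  Literature.AlgebraicGeometry.Motives.ProjBaseChange.algebraBase
  UniversalHyperplaneSection.sectionsAlgebra ProjFamily.functionFieldAlgebra

namespace ProjFamily

open ProjBaseChangeRing ProjectiveSpaceCells ProjectiveSpace Literature.RingTheory.MvPolynomial

variable {k : Type u} [Field k]

/-! ### Small lemmas -/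

/-- A preimmersion is surjective on residue fields. [folklore] -/
theorem residueFieldMap_surjective_of_isPreimmersion {X Y : Scheme.{u}} (f : X ⟶ Y)
    [IsPreimmersion f] (x : X) : Function.Surjective (f.residueFieldMap x) :=
  residueFieldMap_surjective_of_stalkMap_surjective f x (f.stalkMap_surjective x)

/-- A closed point has dimension `0`. [folklore] -/
theorem height_eq_zero_of_isClosed_singleton {Y : Scheme.{u}} {x : Y} (hx : IsClosed ({x} : Set Y)) :
    height x = 0 := by
  refine Order.height_eq_zero.mpr fun y hy => ?_
  have hxy : x ⤳ y := Scheme.le_iff_specializes.mp hy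
  have hmem : y ∈ closure ({x} : Set Y) := specializes_iff_mem_closure.mp hxy
  rw [hx.closure_eq, Set.mem_singleton_iff] at hmem
  exact le_of_eq hmem.symm

/-- A `k`-scheme with quasi-compact structure morphism is quasi-compact. [folklore] -/
theorem compactSpace_of_quasiCompact_hom (Y : SchemeOver k) [QuasiCompact Y.hom] :
    CompactSpace Y.left := by
  constructor
  have h := QuasiCompact.isCompact_preimage (f := Y.hom) (U := (⊤ : (Spec (.of k)).Opens))
    isOpen_univ isCompact_univ
  simpa using h

/-! ### `K`-points of the generic fibre from `k`-morphisms `Spec K → X` -/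

section KPoints

variable (N : ℕ) (B : SchemeOver k) [IsIntegral B.left] (X : SchemeOver k)
  (i : X ⟶ projectiveSpace N k)
  (a : Spec B.left.functionField ⟶ X.left) (ha : a ≫ X.hom = qgen B ≫ B.hom)

/-- The `K`-point `(a, η) : Spec K → X ×ₖ B` of the product. [folklore] -/
def liftPt : Spec B.left.functionField ⟶ (X ⊗ B).left := pullback.lift a (qgen B) ha

/-- `(a, η) ≫ pr₁ = a`. [folklore] -/
theorem liftPt_fst : liftPt B X a ha ≫ (CartesianMonoidalCategory.fst X B).left = a :=
  pullback.lift_fst _ _ _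

/-- `(a, η) ≫ pr₂ = η`. [folklore] -/
theorem liftPt_snd : liftPt B X a ha ≫ (CartesianMonoidalCategory.snd X B).left = qgen B :=
  pullback.lift_snd _ _ _

/-- The `K`-point of the generic fibre `X_K` defined by `a`. [folklore] -/
def tPt : Spec B.left.functionField ⟶ XK B X :=
  pullback.lift (liftPt B X a ha) (𝟙 _) (by rw [liftPt_snd, Category.id_comp])

/-- `tPt ≫ (X_K → X × B) = (a, η)`. [folklore] -/
theorem tPt_ιX : tPt B X a ha ≫ ιX B X = liftPt B X a ha := pullback.lift_fst _ _ _

/-- `tPt` is a section of `X_K → Spec K`. [folklore] -/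
theorem tPt_pX : tPt B X a ha ≫ pX B X = 𝟙 _ := pullback.lift_snd _ _ _

/-- The `K`-point of `ℙᴺ_K` defined by `a`: `Spec K → X_K → ℙᴺ_K`. [folklore] -/
def sPt : Spec B.left.functionField ⟶ (projectiveSpace N B.left.functionField).left :=
  tPt B X a ha ≫ iK N B X i

/-- `sPt` is a section of `ℙᴺ_K → Spec K`. [folklore] -/
theorem sPt_projToSpec :
    sPt N B X i a ha ≫ projToSpec (Fin (N + 1)) B.left.functionField = 𝟙 _ := by
  rw [sPt, Category.assoc, iK_projToSpec, tPt_pX]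

/-- The point of `X_K` under `a`. [folklore] -/
def uXPt : ↥(XK B X) := (tPt B X a ha).base (IsLocalRing.closedPoint B.left.functionField)

/-- The point of `ℙᴺ_K` under `a`. [folklore] -/
def uPt : ↥(projectiveSpace N B.left.functionField).left :=
  (sPt N B X i a ha).base (IsLocalRing.closedPoint B.left.functionField)

/-- `iK (uXPt) = uPt`. [folklore] -/
theorem iK_uXPt : (iK N B X i).base (uXPt B X a ha) = uPt N B X i a ha := rfl

/-- `pr₁ (ι (uXPt a)) = a(pt)`. [folklore] -/
theorem fst_ιX_uXPt : (CartesianMonoidalCategory.fst X B).left.base ((ιX B X).base (uXPt B X a ha)) =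
    a.base (IsLocalRing.closedPoint B.left.functionField) := by
  change ((tPt B X a ha ≫ ιX B X ≫ (CartesianMonoidalCategory.fst X B).left).base _) = _
  rw [← Category.assoc, tPt_ιX, liftPt_fst]

/-- `sPt` is a closed immersion (a section of the separated `ℙᴺ_K → Spec K`). [folklore] -/
instance isClosedImmersion_sPt : IsClosedImmersion (sPt N B X i a ha) :=
  haveI : Subsingleton ↥(Spec B.left.functionField) :=
    inferInstanceAs (Subsingleton (PrimeSpectrum B.left.functionField))
  isClosedImmersion_of_comp_eq_id _ _ (sPt_projToSpec N B X i a ha)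

/-- `uPt a` is a closed point. [folklore] -/
theorem isClosed_uPt : IsClosed ({uPt N B X i a ha} : Set ↥(projectiveSpace N B.left.functionField).left) := by
  have h : Set.range (sPt N B X i a ha).base = {uPt N B X i a ha} := by
    haveI : Subsingleton ↥(Spec B.left.functionField) :=
      inferInstanceAs (Subsingleton (PrimeSpectrum B.left.functionField))
    ext y
    simp only [Set.mem_range, Set.mem_singleton_iff]
    constructor
    · rintro ⟨p, rfl⟩
      rw [Subsingleton.elim p (IsLocalRing.closedPoint B.left.functionField)]
      rfl
    · rintro rfl
      exact ⟨_, rfl⟩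
  rw [← h]
  exact (sPt N B X i a ha).isClosedEmbedding.isClosed_range

/-- `uPt a` has dimension `0`. [folklore] -/
theorem height_uPt : height (uPt N B X i a ha) = 0 :=
  height_eq_zero_of_isClosed_singleton (isClosed_uPt N B X i a ha)

/-- `uPt a` is `K`-rational: `[κ(uPt a) : K] = 1`. [folklore] -/
theorem residueDegree_uPt :
    (projectiveSpace N B.left.functionField).hom.residueDegree (uPt N B X i a ha) = 1 := by
  refine residueDegree_eq_one_of_residueFieldMap_surjective _ _
    (residueFieldMap_surjective_of_comp (sPt N B X i a ha) _ _ ?_)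
  have key : ∀ (g : Spec B.left.functionField ⟶ Spec B.left.functionField), g = 𝟙 _ →
      ∀ x, Function.Surjective (g.residueFieldMap x) := by
    rintro g rfl x
    exact residueFieldMap_surjective_of_isPreimmersion _ x
  exact key _ (by rw [projectiveSpace_hom_eq_projToSpec]; exact sPt_projToSpec N B X i a ha) _

/-- The `K`-point `a` as an element of `ℙᴺ_K(K)` (`AlgPoints`). [folklore] -/
def algPt : AlgPoints (projectiveSpace N B.left.functionField) B.left.functionField :=
  AlgPoints.mk (sPt N B X i a ha) (by
    rw [projectiveSpace_hom_eq_projToSpec, sPt_projToSpec]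
    change 𝟙 _ = Spec.map (𝟙 _)
    rw [Spec.map_id])

/-- The underlying point of `algPt a` is `uPt a`. [folklore] -/
theorem pt_algPt : (algPt N B X i a ha).pt = uPt N B X i a ha := rfl

/-- `i (a pt) = (ℙᴺ_K → ℙᴺ_k) (uPt a)`. [folklore] -/
theorem i_apply_eq_projMap_uPt : i.left.base (a.base (IsLocalRing.closedPoint B.left.functionField)) =
    (Proj.map (mapGraded k B.left.functionField (Fin (N + 1)))
      (irrelevant_le_map k B.left.functionField (Fin (N + 1)))).base (uPt N B X i a ha) := by
  have h2 : (Proj.map (mapGraded k B.left.functionField (Fin (N + 1)))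
      (irrelevant_le_map k B.left.functionField (Fin (N + 1)))).base (uPt N B X i a ha) =
      ((iK N B X i ≫ genericFibreι N B ≫
        (CartesianMonoidalCategory.fst (projectiveSpace N k) B).left).base (uXPt B X a ha)) := by
    rw [genericFibreι_fst]
    rfl
  rw [h2, ← fst_ιX_uXPt B X a ha]
  change (((ιX B X) ≫ (CartesianMonoidalCategory.fst X B).left ≫ i.left).base (uXPt B X a ha)) = _
  rw [← whiskerRight_left_fst N B X i, ← Category.assoc (ιX B X), ← iK_genericFibreι N B X i,
    Category.assoc]

/-- A form vanishing at `i (a pt)` vanishes, after scalar extension, at `uPt a`. [folklore] -/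
theorem map_mem_asHomogeneousIdeal_uPt {G : MvPolynomial (Fin (N + 1)) k}
    (hG : G ∈ ProjectiveSpectrum.asHomogeneousIdeal (𝒜 := homogeneousSubmodule (Fin (N + 1)) k)
      (i.left.base (a.base (IsLocalRing.closedPoint B.left.functionField)))) :
    MvPolynomial.map (algebraMap k B.left.functionField) G ∈
      ProjectiveSpectrum.asHomogeneousIdeal
        (𝒜 := homogeneousSubmodule (Fin (N + 1)) B.left.functionField) (uPt N B X i a ha) := by
  rw [i_apply_eq_projMap_uPt N B X i a ha] at hG
  exact hG

end KPoints

/-! ### The line through two independent vectors and the generic fibre -/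

section LineForms

variable {K : Type u} [Field K] [Infinite K] {N : ℕ}

/-- **The linear forms of the line through two independent vectors**: `N - 1` independent linear
forms vanishing at `v₁, v₂` such that every polynomial vanishing on `span(v₁, v₂)` lies in their
ideal (coordinate forms of a basis extending `v₁, v₂`; `K` infinite). [folklore] -/
theorem exists_lineForms (v : Fin 2 → Fin (N + 1) → K) (hv : LinearIndependent K v) (hN : 1 ≤ N) :
    ∃ L : Fin (N - 1) → MvPolynomial (Fin (N + 1)) K, LinearIndependent K L ∧
      (∀ l, (L l).IsHomogeneous 1) ∧ (∀ l a, eval (v a) (L l) = 0) ∧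
      ∀ F : MvPolynomial (Fin (N + 1)) K, (∀ s t : K, eval (s • v 0 + t • v 1) F = 0) →
        F ∈ Ideal.span (Set.range L) := by
  classical
  obtain ⟨b, hb⟩ := exists_basis_extending (m := N - 1) v hv (by omega)
  let cf : Fin (N + 1) → MvPolynomial (Fin (N + 1)) K :=
    fun j => ∑ m : Fin (N + 1), C (b.repr (Pi.single m 1) j) * MvPolynomial.X m
  let e : Fin (N - 1) → Fin (N + 1) := fun l => ⟨l, by omega⟩
  have he : Function.Injective e := fun l l' h => Fin.ext (by simpa [e] using congrArg Fin.val h)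
  refine ⟨fun l => cf (e l), (linearIndependent_coordForm b).comp e he,
    fun l => isHomogeneous_coordForm b (e l), fun l a => ?_, fun F hF => ?_⟩
  · change eval (v a) (cf (e l)) = 0
    rw [eval_coordForm, ← hb a, b.repr_self, Finsupp.single_apply, if_neg]
    intro h
    have := congrArg Fin.val h
    simp [e] at this
    omega
  · have hT := mem_ideal_span_coordForm_of_forall_eval_eq_zero b (Set.range e) F (fun c hc => ?_)
    · have hset : (fun j => cf j) '' Set.range e = Set.range fun l => cf (e l) := by
        ext G; simp [Set.mem_image, Set.mem_range]
      rw [hset] at hT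
      exact hT
    · -- a vector with vanishing `T`-coordinates is `c_{N-1} v₀ + c_N v₁`
      have hsum : (fun m => ∑ j, c j * b j m) =
          c ⟨N - 1, by omega⟩ • v 0 + c ⟨N, by omega⟩ • v 1 := by
        have e0 : (⟨N - 1 + ((0 : Fin 2) : ℕ), by simp⟩ : Fin (N + 1)) = ⟨N - 1, by omega⟩ :=
          Fin.ext (by simp)
        have e1 : (⟨N - 1 + ((1 : Fin 2) : ℕ), by simp; omega⟩ : Fin (N + 1)) = ⟨N, by omega⟩ :=
          Fin.ext (by simp; omega)
        have h0 : b ⟨N - 1, by omega⟩ = v 0 := by rw [← e0]; exact hb 0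
        have h1 : b ⟨N, by omega⟩ = v 1 := by rw [← e1]; exact hb 1
        have hne : (⟨N - 1, by omega⟩ : Fin (N + 1)) ≠ ⟨N, by omega⟩ :=
          Fin.ne_of_val_ne (by simp only [ne_eq]; omega)
        funext m
        simp only [Pi.add_apply, Pi.smul_apply, smul_eq_mul]
        rw [← Finset.sum_subset (Finset.subset_univ
            ({(⟨N - 1, by omega⟩ : Fin (N + 1)), ⟨N, by omega⟩} : Finset (Fin (N + 1)))),
          Finset.sum_pair hne, h0, h1]
        intro j _ hj
        simp only [Finset.mem_insert, Finset.mem_singleton, not_or] at hj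
        have h1' : (j : ℕ) ≠ N - 1 := fun h => hj.1 (Fin.ext h)
        have h2' : (j : ℕ) ≠ N := fun h => hj.2 (Fin.ext h)
        have hjlt : (j : ℕ) < N - 1 := by have := j.2; omega
        rw [hc j ⟨⟨j, hjlt⟩, Fin.ext rfl⟩, zero_mul]
      rw [hsum]
      exact hF _ _

end LineForms

/-! ### `K`-points of `ℙᴺ_K` are closed points of degree one -/

section AlgPointsPN

variable {K : Type u} [Field K] {N : ℕ}

/-- The structure morphism of a `K`-point of `ℙᴺ_K` over `K` is a section of `ℙᴺ_K → Spec K`.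
[folklore] -/
theorem algPoints_left_comp_projToSpec (P : AlgPoints (projectiveSpace N K) K) :
    P.left ≫ projToSpec (Fin (N + 1)) K = 𝟙 _ := by
  have h := Over.w P
  rw [projectiveSpace_hom_eq_projToSpec] at h
  rw [h]
  change Spec.map (𝟙 _) = 𝟙 _
  rw [Spec.map_id]

/-- A `K`-point of `ℙᴺ_K` is a closed immersion `Spec K → ℙᴺ_K`. [folklore] -/
instance isClosedImmersion_algPoints_left (P : AlgPoints (projectiveSpace N K) K) :
    IsClosedImmersion P.left :=
  haveI : Subsingleton ↥(specOver K K).left := inferInstanceAs (Subsingleton (PrimeSpectrum K))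
  isClosedImmersion_of_comp_eq_id _ _ (algPoints_left_comp_projToSpec P)

/-- The underlying point of a `K`-point of `ℙᴺ_K` is closed. [folklore] -/
theorem isClosed_pt (P : AlgPoints (projectiveSpace N K) K) :
    IsClosed ({P.pt} : Set ↥(projectiveSpace N K).left) := by
  haveI : Subsingleton ↥(specOver K K).left := inferInstanceAs (Subsingleton (PrimeSpectrum K))
  have h : Set.range P.left.base = {P.pt} := by
    ext y
    simp only [Set.mem_range, Set.mem_singleton_iff]
    constructor
    · rintro ⟨p, rfl⟩
      rw [Subsingleton.elim p (IsLocalRing.closedPoint K)]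
      rfl
    · rintro rfl
      exact ⟨IsLocalRing.closedPoint K, rfl⟩
  rw [← h]
  exact P.left.isClosedEmbedding.isClosed_range

/-- The underlying point of a `K`-point of `ℙᴺ_K` has dimension `0`. [folklore] -/
theorem height_pt (P : AlgPoints (projectiveSpace N K) K) : height P.pt = 0 :=
  height_eq_zero_of_isClosed_singleton (isClosed_pt P)

/-- A `K`-point of `ℙᴺ_K` has residue degree `1`. [folklore] -/
theorem residueDegree_pt (P : AlgPoints (projectiveSpace N K) K) :
    (projectiveSpace N K).hom.residueDegree P.pt = 1 := by
  refine residueDegree_eq_one_of_residueFieldMap_surjective _ _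
    (residueFieldMap_surjective_of_comp P.left _ _ ?_)
  have key : ∀ (g : Spec (CommRingCat.of K) ⟶ Spec (CommRingCat.of K)), g = 𝟙 _ →
      ∀ x, Function.Surjective (g.residueFieldMap x) := by
    rintro g rfl x
    exact residueFieldMap_surjective_of_isPreimmersion _ x
  exact key _ (by rw [projectiveSpace_hom_eq_projToSpec]; exact algPoints_left_comp_projToSpec P) _

/-- A linear form vanishing at the vector `z` vanishes at the point `[z]`. [folklore] -/
theorem mem_asHomogeneousIdeal_pt_pointOfVec {z : Fin (N + 1) → K} (hz : z ≠ 0)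
    {G : MvPolynomial (Fin (N + 1)) K} {m : ℕ} (hm : 0 < m) (hG : G.IsHomogeneous m)
    (hGz : eval z G = 0) :
    G ∈ ProjectiveSpectrum.asHomogeneousIdeal (𝒜 := homogeneousSubmodule (Fin (N + 1)) K)
      (pointOfVec K z hz).pt := by
  have h := (pt_pointOfVec_mem_zeroLocus_iff (k := K) z hz hm
    ((mem_homogeneousSubmodule m G).mpr hG)).2 (by
      rw [show aeval z G = eval z G from congrFun (MvPolynomial.aeval_eq_eval (f := z)) G]
      exact hGz)
  exact h (Set.mem_singleton G)

/-- Conversely, a form vanishing at the point `[z]` vanishes at the vector `z`. [folklore] -/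
theorem eval_eq_zero_of_mem_asHomogeneousIdeal_pt_pointOfVec {z : Fin (N + 1) → K} (hz : z ≠ 0)
    {G : MvPolynomial (Fin (N + 1)) K} {m : ℕ} (hm : 0 < m) (hG : G.IsHomogeneous m)
    (hmem : G ∈ ProjectiveSpectrum.asHomogeneousIdeal (𝒜 := homogeneousSubmodule (Fin (N + 1)) K)
      (pointOfVec K z hz).pt) : eval z G = 0 := by
  have h := (pt_pointOfVec_mem_zeroLocus_iff (k := K) z hz hm
    ((mem_homogeneousSubmodule m G).mpr hG)).1 (fun _ hG' => by
      rw [Set.mem_singleton_iff.mp hG']; exact hmem)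
  rwa [show aeval z G = eval z G from congrFun (MvPolynomial.aeval_eq_eval (f := z)) G] at h

end AlgPointsPN

/-! ### The line through two points lies in the generic fibre -/

section Hline

variable (N : ℕ) (B : SchemeOver k) [IsIntegral B.left] (X : SchemeOver k)
  (i : X ⟶ projectiveSpace N k)

omit [IsIntegral B.left] in
/-- The square `pr₁ ∘ (i × B) = i ∘ pr₁` is cartesian (as
`Motives/AlgebraicEquivalenceWhiskerRight.isPullback_whiskerRight_fst`). [folklore] -/
theorem isPullback_whiskerRight_fst' :
    IsPullback (CartesianMonoidalCategory.fst X B).left (i ▷ B).left i.left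
      (CartesianMonoidalCategory.fst (projectiveSpace N k) B).left := by
  have t : IsPullback (CartesianMonoidalCategory.fst (projectiveSpace N k) B).left
      (CartesianMonoidalCategory.snd (projectiveSpace N k) B).left (projectiveSpace N k).hom B.hom :=
    IsPullback.of_hasPullback _ _
  have big : IsPullback (CartesianMonoidalCategory.fst X B).left
      ((i ▷ B).left ≫ (CartesianMonoidalCategory.snd (projectiveSpace N k) B).left)
      (i.left ≫ (projectiveSpace N k).hom) B.hom := by
    rw [whiskerRight_left_snd, Over.w i]
    exact IsPullback.of_hasPullback _ _
  refine big.of_bot ?_ t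
  rw [whiskerRight_left_fst]

omit [IsIntegral B.left] in
/-- The image of `i × B` is `pr₁⁻¹(i(X))`. [folklore] -/
theorem range_whiskerRight_left : Set.range (i ▷ B).left.base =
    (CartesianMonoidalCategory.fst (projectiveSpace N k) B).left.base ⁻¹' Set.range i.left.base :=
  Literature.AlgebraicGeometry.Limits.range_fst_of_isPullback (isPullback_whiskerRight_fst' N B X i).flip

/-- The image of `X_K → ℙᴺ_K` is the preimage of the image of `i × B` under the generic fibre.
[folklore] -/
theorem range_iK : Set.range (iK N B X i).base =
    (genericFibreι N B).base ⁻¹' Set.range (i ▷ B).left.base :=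
  Literature.AlgebraicGeometry.Limits.range_fst_of_isPullback (isPullback_iK N B X i)

/-- **The line lies in `X_K`**: if the equations of `X = V₊(F) ⊆ ℙᴺ` lie, after scalar extension
to `K`, in the ideal of the linear forms `μ`, then `V₊(μ) ⊆ ℙᴺ_K` lies in the generic fibre
`X_K`. [folklore] -/
theorem zeroLocus_subset_range_iK {c : ℕ} (F : Fin c → MvPolynomial (Fin (N + 1)) k)
    (hrange : Set.range i.left.base =
      ProjectiveSpectrum.zeroLocus (homogeneousSubmodule (Fin (N + 1)) k) (Set.range F))
    {t : ℕ} (μ : Fin t → MvPolynomial (Fin (N + 1)) B.left.functionField)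
    (hF : ∀ b, MvPolynomial.map (algebraMap k B.left.functionField) (F b) ∈ Ideal.span (Set.range μ)) :
    ProjectiveSpectrum.zeroLocus (homogeneousSubmodule (Fin (N + 1)) B.left.functionField)
      (Set.range μ) ⊆ Set.range (iK N B X i).base := by
  intro x hx
  refine (Set.ext_iff.mp (range_iK N B X i) x).mpr ?_
  rw [Set.mem_preimage]
  refine (Set.ext_iff.mp (range_whiskerRight_left N B X i) _).mpr ?_
  rw [Set.mem_preimage]
  refine (Set.ext_iff.mp hrange _).mpr ?_
  have hfst : (CartesianMonoidalCategory.fst (projectiveSpace N k) B).left.base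
      ((genericFibreι N B).base x) = (Proj.map (mapGraded k B.left.functionField (Fin (N + 1)))
        (irrelevant_le_map k B.left.functionField (Fin (N + 1)))).base x := by
    change ((genericFibreι N B ≫ (CartesianMonoidalCategory.fst (projectiveSpace N k) B).left).base x) = _
    rw [genericFibreι_fst]
    rfl
  rw [hfst]
  rintro _ ⟨b, rfl⟩
  change F b ∈ ProjectiveSpectrum.asHomogeneousIdeal _
  rw [ProjectiveSpectrum.mem_asHomogeneousIdeal_map_iff]
  have hle : Ideal.span (Set.range μ) ≤ (ProjectiveSpectrum.asHomogeneousIdeal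
      (𝒜 := homogeneousSubmodule (Fin (N + 1)) B.left.functionField) x).toIdeal :=
    Ideal.span_le.mpr fun _ ⟨l, hl⟩ => hl ▸ hx ⟨l, rfl⟩
  exact hle (hF b)

end Hline

/-! ### The relation for one line of the chain -/

section PerLine

variable [IsAlgClosed k] {N : ℕ} (B : SchemeOver k) [IsIntegral B.left] [LocallyOfFiniteType B.hom]
  (X : SchemeOver k) (i : X ⟶ projectiveSpace N k) [IsClosedImmersion i.left]

omit [IsAlgClosed k] [LocallyOfFiniteType B.hom] in
/-- `K ⊇ k` is infinite (for `k` infinite). [folklore] -/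
theorem infinite_functionField [Infinite k] : Infinite B.left.functionField :=
  Infinite.of_injective (algebraMap k B.left.functionField) (algebraMap k B.left.functionField).injective

/-- **The relation for one line.** For two independent vectors `v₀, v₁ ∈ Kᴺ⁺¹` such that the
equations of `X` vanish on the plane they span (so the line `[v₀][v₁]` lies in `X_K`), there is
`c' ∈ Rat₁(X ×ₖ B)` with `c' = [ι u₀] - [ι u₁] + vert`, `u_a ∈ X_K` the point `[v_a]`, where every
`z` with `vert z ≠ 0` projects to a LINE of `X`: `pr₁ z` is a line point of `i : X ⊆ ℙᴺ`.
[cite: TianZong2014, proofs of Prop. 3.1 and Prop. 7.2] -/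
theorem exists_relation_of_line (hN : 1 ≤ N) (hB1 : height (genericPoint B.left) = 1)
    (hpid : ∀ b : B.left, IsClosed ({b} : Set B.left) →
      IsPrincipalIdealRing (B.left.presheaf.stalk b))
    {c : ℕ} (F : Fin c → MvPolynomial (Fin (N + 1)) k)
    (hrange : Set.range i.left.base =
      ProjectiveSpectrum.zeroLocus (homogeneousSubmodule (Fin (N + 1)) k) (Set.range F))
    (v : Fin 2 → Fin (N + 1) → B.left.functionField) (hv : LinearIndependent B.left.functionField v)
    (hFv : ∀ b (s t : B.left.functionField),
      eval (s • v 0 + t • v 1) (MvPolynomial.map (algebraMap k B.left.functionField) (F b)) = 0) :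
    ∃ c' ∈ ratTrivial (X ⊗ B).left 1, ∃ uX : Fin 2 → ↥(XK B X),
      (∀ a, (iK N B X i).base (uX a) = (pointOfVec B.left.functionField (v a) (hv.ne_zero a)).pt) ∧
      ∃ vert : AlgebraicCycle (X ⊗ B).left ℤ,
        c' = primeCycle ((ιX B X).base (uX 0)) - primeCycle ((ιX B X).base (uX 1)) + vert ∧
        ∀ z, vert z ≠ 0 → IsLinePoint N i ((CartesianMonoidalCategory.fst X B).left.base z) := by
  haveI := infinite_functionField B
  obtain ⟨μ, hμli, hμhom, hμv, hμideal⟩ := exists_lineForms v hv hN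
  have hFspan : ∀ b, MvPolynomial.map (algebraMap k B.left.functionField) (F b) ∈
      Ideal.span (Set.range μ) := fun b => hμideal _ (hFv b)
  have hline := zeroLocus_subset_range_iK N B X i F hrange μ hFspan
  have hu : ∀ a, (pointOfVec B.left.functionField (v a) (hv.ne_zero a)).pt ∈
      ProjectiveSpectrum.zeroLocus (homogeneousSubmodule (Fin (N + 1)) B.left.functionField)
        (Set.range μ) := by
    rintro a _ ⟨l, rfl⟩
    exact mem_asHomogeneousIdeal_pt_pointOfVec (hv.ne_zero a) zero_lt_one (hμhom l) (hμv l a)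
  obtain ⟨c', hc', uX, vX, huX, hvX, vert, hcv, hvert⟩ :=
    exists_relation_of_two_points_on_line B X i hN hB1 hpid μ hμli hμhom hline (hu 0) (hu 1)
      (height_pt _) (height_pt _) (by rw [residueDegree_pt, residueDegree_pt])
  refine ⟨c', hc', ![uX, vX], fun a => ?_, vert, ?_, fun z hz => ?_⟩
  · fin_cases a
    · exact huX
    · exact hvX
  · simpa using hcv
  · obtain ⟨-, -, L, hLli, hLhom, hcl⟩ := hvert z hz
    refine (isLinePoint_iff_exists_image_eq i hN _).mpr ⟨L, hLli, hLhom, ?_⟩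
    rw [← hcl, ← i.left.isClosedEmbedding.closure_image_eq, Set.image_singleton]

end PerLine

/-! ### Push-forward to `X` and the main relation -/

section Main

variable [IsAlgClosed k] {N : ℕ} (B : SchemeOver k) [IsIntegral B.left] [IsProper B.hom]
  (X : SchemeOver k) (i : X ⟶ projectiveSpace N k) [IsClosedImmersion i.left]

omit [IsAlgClosed k] in
/-- The support of the push-forward of a cycle supported on `s` lies in the image of `s`.
[folklore] -/
theorem support_map_subset {Y Z : Scheme.{u}} (f : Y ⟶ Z) [QuasiCompact f] (c : AlgebraicCycle Y ℤ)
    (s : Finset Y) (hs : Function.support c ⊆ (s : Set Y)) [DecidableEq Z] :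
    Function.support (AlgebraicCycle.map f height height c) ⊆ (s.image f.base : Set Z) := by
  classical
  let M : AlgebraicCycle Y ℤ →+ AlgebraicCycle Z ℤ :=
    AddMonoidHom.mk' (AlgebraicCycle.map f height height) (algebraicCycleMap_add f height height)
  intro y hy
  rw [Function.mem_support, eq_sum_smul_primeCycle_of_support_subset c hs] at hy
  change M (∑ z ∈ s, c z • primeCycle z) y ≠ 0 at hy
  rw [map_sum] at hy
  simp only [Function.locallyFinsuppWithin.coe_sum, Finset.sum_apply] at hy
  obtain ⟨z, hz, hne⟩ := Finset.exists_ne_zero_of_sum_ne_zero hy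
  rw [map_zsmul] at hne
  change (c z • AlgebraicCycle.map f height height (primeCycle z)) y ≠ 0 at hne
  rw [algebraicCycleMap_primeCycle_eq_nsmul] at hne
  have hyz : y = f.base z := by
    by_contra h
    apply hne
    simp [primeCycle_apply_of_ne h]
  rw [Finset.coe_image]
  exact ⟨z, hz, hyz.symm⟩

omit [IsAlgClosed k] in
/-- Two nonzero vectors which are not linearly independent are proportional. [folklore] -/
theorem exists_eq_smul_of_not_linearIndependent {K : Type u} [Field K] {V : Type*} [AddCommGroup V]
    [Module K V] {z z' : V} (hz : z ≠ 0) (hz' : z' ≠ 0) (h : ¬ LinearIndependent K ![z, z']) :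
    ∃ c : K, c ≠ 0 ∧ z' = c • z := by
  rw [LinearIndependent.pair_iff] at h
  push Not at h
  obtain ⟨s, t, hst, hne⟩ := h
  have ht : t ≠ 0 := by
    intro ht
    rw [ht, zero_smul, add_zero] at hst
    exact hne (smul_eq_zero.mp hst |>.resolve_right hz) ht
  have hs : s ≠ 0 := by
    intro hs
    rw [hs, zero_smul, zero_add] at hst
    exact ht (smul_eq_zero.mp hst |>.resolve_right hz')
  refine ⟨-(s / t), by simp [hs, ht], ?_⟩
  have h1 : t • z' = -(s • z) := eq_neg_of_add_eq_zero_right hst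
  calc z' = t⁻¹ • (t • z') := by rw [smul_smul, inv_mul_cancel₀ ht, one_smul]
    _ = -(s / t) • z := by rw [h1, smul_neg, smul_smul, neg_smul, div_eq_inv_mul]

/-- **The product trick relation** (Tian–Zong, proof of Prop. 7.2). Let `X = V₊(F) ⊆ ℙᴺ_k` be closed
with `F` of degrees `d`, `0 < d_b`, `Σ d_b² ≤ N`, over `k` algebraically closed; `B` an integral
proper `k`-scheme, locally of finite type, with generic point of dimension `1`, principal local
rings at closed points and `trdeg_k k(B) = 1` (a smooth proper curve); and `a : Spec k(B) → X` a
`k`-morphism whose image point `z₀` has dimension `1` and the same residue field (`B → closure z₀`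
birational, e.g. the normalization). Then `[closure z₀]` is rationally equivalent on `X` to an
integral combination of LINES. [cite: TianZong2014, Prop. 7.2 (proof)] -/
theorem exists_lines_of_birational_curve (hN : 1 ≤ N) (hB1 : height (genericPoint B.left) = 1)
    (hpid : ∀ b : B.left, IsClosed ({b} : Set B.left) →
      IsPrincipalIdealRing (B.left.presheaf.stalk b))
    (htr : Algebra.trdeg k B.left.functionField = 1)
    {c : ℕ} (F : Fin c → MvPolynomial (Fin (N + 1)) k) (d : Fin c → ℕ)
    (hFhom : ∀ b, (F b).IsHomogeneous (d b)) (hd : ∀ b, 0 < d b)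
    (hrange : Set.range i.left.base =
      ProjectiveSpectrum.zeroLocus (homogeneousSubmodule (Fin (N + 1)) k) (Set.range F))
    (hsq : ∑ b, d b ^ 2 ≤ N)
    (a : Spec B.left.functionField ⟶ X.left) (ha : a ≫ X.hom = qgen B ≫ B.hom)
    (hz : height (a.base (IsLocalRing.closedPoint B.left.functionField)) = 1)
    (hasurj : Function.Surjective
      (a.residueFieldMap (IsLocalRing.closedPoint B.left.functionField))) :
    ∃ (s : Finset ↥X.left) (w : ↥X.left → ℤ), (∀ y ∈ s, IsLinePoint N i y) ∧
      IsRationallyEquivalent (primeCycle (a.base (IsLocalRing.closedPoint B.left.functionField)))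
        (∑ y ∈ s, w y • primeCycle y) 1 := by
  classical
  -- instances
  haveI : IsProper (projectiveSpace N k).hom := isProper_projectiveSpace N k
  haveI : IsProper X.hom := by rw [← Over.w i]; infer_instance
  haveI : LocallyOfFiniteType (X ⊗ B).hom :=
    inferInstanceAs (LocallyOfFiniteType (pullback.fst X.hom B.hom ≫ X.hom))
  haveI : IsProper (CartesianMonoidalCategory.fst X B).left :=
    inferInstanceAs (IsProper (pullback.fst X.hom B.hom))
  haveI : QuasiCompact (X ⊗ B).hom :=
    inferInstanceAs (QuasiCompact (pullback.fst X.hom B.hom ≫ X.hom))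
  haveI : CompactSpace ↥(X ⊗ B).left := compactSpace_of_quasiCompact_hom (X ⊗ B)
  haveI := infinite_functionField (k := k) B
  have hP := isPullback_ιX B X
  have hi := range_qgen B
  have hinjK : Function.Injective (iK N B X i).base := (iK N B X i).isClosedEmbedding.injective
  -- a closed point `x₀` of `X` below `z₀`
  obtain ⟨x₀, hx₀lt⟩ : ∃ x₀, x₀ < a.base (IsLocalRing.closedPoint B.left.functionField) := by
    have h : ¬ IsMin (a.base (IsLocalRing.closedPoint B.left.functionField)) := fun hmin => by
      have := Order.height_eq_zero.mpr hmin
      rw [hz] at this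
      exact one_ne_zero this
    simpa [not_isMin_iff] using h
  have hx₀0 : height x₀ = 0 := by
    have h := height_strictMono hx₀lt (by
      refine lt_of_le_of_lt (height_mono hx₀lt.le) ?_
      rw [hz]; exact ENat.coe_lt_top 1)
    rw [hz] at h
    exact Order.lt_one_iff.mp h
  have hx₀ : IsClosed ({x₀} : Set ↥X.left) := isClosed_singleton_of_height_eq_zero' hx₀0
  -- the constant `K`-point at `x₀`
  let a₀ : Spec B.left.functionField ⟶ X.left := qgen B ≫ B.hom ≫ pointOfClosedPoint X.hom x₀ hx₀
  have ha₀ : a₀ ≫ X.hom = qgen B ≫ B.hom := by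
    simp only [a₀, Category.assoc, pointOfClosedPoint_comp, Category.comp_id]
  have ha₀pt : a₀.base (IsLocalRing.closedPoint B.left.functionField) = x₀ :=
    pointOfClosedPoint_apply X.hom x₀ hx₀ _
  -- homogeneous coordinates of the two `K`-points
  obtain ⟨p, hp0, hPp⟩ := exists_eq_pointOfVec (algPt N B X i a ha)
  obtain ⟨q, hq0, hPq⟩ := exists_eq_pointOfVec (algPt N B X i a₀ ha₀)
  have hptp : (pointOfVec B.left.functionField p hp0).pt = uPt N B X i a ha := by
    rw [← hPp]; rfl
  have hptq : (pointOfVec B.left.functionField q hq0).pt = uPt N B X i a₀ ha₀ := by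
    rw [← hPq]; rfl
  -- the equations vanish at `p` and `q`
  have hFmem : ∀ (a' : Spec B.left.functionField ⟶ X.left) (ha' : a' ≫ X.hom = qgen B ≫ B.hom) b,
      MvPolynomial.map (algebraMap k B.left.functionField) (F b) ∈
        ProjectiveSpectrum.asHomogeneousIdeal
          (𝒜 := homogeneousSubmodule (Fin (N + 1)) B.left.functionField) (uPt N B X i a' ha') := by
    intro a' ha' b
    refine map_mem_asHomogeneousIdeal_uPt N B X i a' ha' ?_
    have hmem : i.left.base (a'.base (IsLocalRing.closedPoint B.left.functionField)) ∈
        Set.range i.left.base := ⟨_, rfl⟩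
    rw [hrange] at hmem
    exact hmem ⟨b, rfl⟩
  have hFp : ∀ b, eval p (MvPolynomial.map (algebraMap k B.left.functionField) (F b)) = 0 :=
    fun b => eval_eq_zero_of_mem_asHomogeneousIdeal_pt_pointOfVec hp0 (hd b) ((hFhom b).map _)
      (hptp ▸ hFmem a ha b)
  have hFq : ∀ b, eval q (MvPolynomial.map (algebraMap k B.left.functionField) (F b)) = 0 :=
    fun b => eval_eq_zero_of_mem_asHomogeneousIdeal_pt_pointOfVec hq0 (hd b) ((hFhom b).map _)
      (hptq ▸ hFmem a₀ ha₀ b)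
  -- `p` and `q` are independent (the points differ: `z₀ ≠ x₀`)
  have hpq : LinearIndependent B.left.functionField ![p, q] := by
    by_contra hdep
    obtain ⟨c₀, hc₀, hqc⟩ := exists_eq_smul_of_not_linearIndependent hp0 hq0 hdep
    have heq : pointOfVec B.left.functionField p hp0 = pointOfVec B.left.functionField q hq0 :=
      (pointOfVec_eq_pointOfVec_iff p q hp0 hq0).mpr ⟨c₀, hc₀, hqc⟩
    have hzx : a.base (IsLocalRing.closedPoint B.left.functionField) = x₀ := by
      apply i.left.isClosedEmbedding.injective
      rw [← ha₀pt, i_apply_eq_projMap_uPt N B X i a ha, i_apply_eq_projMap_uPt N B X i a₀ ha₀,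
        ← hptp, ← hptq, heq]
    rw [hzx, hx₀0] at hz
    exact zero_ne_one hz
  -- Tsen: a common point `r` of the cones over `p` and `q`
  have hK : ∀ {ι : Type} [Fintype ι] (g : ι → MvPolynomial (Fin (N + 1)) B.left.functionField)
      (e : ι → ℕ), (∀ j, 0 < e j) → (∀ j, (g j).IsHomogeneous (e j)) → ∑ j, e j < N + 1 →
      ∃ x : Fin (N + 1) → B.left.functionField, x ≠ 0 ∧ ∀ j, eval x (g j) = 0 :=
    fun g e he hg hn => Literature.FieldTheory.QuasiAlgClosed.exists_common_zero_of_trdeg_eq_one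
      htr g e he hg (by simpa using hn)
  obtain ⟨r, hr0, hr⟩ := exists_two_line_chain hK
    (F := fun b => MvPolynomial.map (algebraMap k B.left.functionField) (F b)) (d := d)
    (fun b => (hFhom b).map _) hd (by omega) hFp hFq
  -- push-forward along `pr₁ : X × B → X`
  let M : AlgebraicCycle (X ⊗ B).left ℤ →+ AlgebraicCycle X.left ℤ :=
    AddMonoidHom.mk' (AlgebraicCycle.map (CartesianMonoidalCategory.fst X B).left height height)
      (algebraicCycleMap_add _ height height)
  have hMrat : ∀ c' ∈ ratTrivial (X ⊗ B).left 1, M c' ∈ ratTrivial X.left 1 :=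
    fun c' hc' => map_mem_ratTrivial_holds (d := 1) (CartesianMonoidalCategory.fst X B) hc'
  -- (i) the section through `a` pushes forward to `[z₀]`
  have hliftpt : (ιX B X).base (uXPt B X a ha) =
      (liftPt B X a ha).base (IsLocalRing.closedPoint B.left.functionField) := by
    change ((tPt B X a ha ≫ ιX B X).base _) = _
    rw [tPt_ιX]
  have hMa : M (primeCycle ((ιX B X).base (uXPt B X a ha))) =
      primeCycle (a.base (IsLocalRing.closedPoint B.left.functionField)) := by
    rw [hliftpt]
    change AlgebraicCycle.map (CartesianMonoidalCategory.fst X B).left height height _ = _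
    haveI : LocallyOfFiniteType ((CartesianMonoidalCategory.fst X B).left ≫ X.hom) :=
      inferInstanceAs (LocallyOfFiniteType (X ⊗ B).hom)
    rw [algebraicCycleMap_primeCycle_of_residueFieldMap_surjective
      (CartesianMonoidalCategory.fst X B).left X.hom ((liftPt B X a ha).base _) ?_]
    · congr 1
      change ((liftPt B X a ha ≫ (CartesianMonoidalCategory.fst X B).left).base _) = _
      rw [liftPt_fst]
    · refine residueFieldMap_surjective_of_comp (liftPt B X a ha) _ _ ?_
      have key : ∀ g : Spec B.left.functionField ⟶ X.left, g = a →
          Function.Surjective (g.residueFieldMap (IsLocalRing.closedPoint B.left.functionField)) := by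
        rintro g rfl; exact hasurj
      exact key _ (liftPt_fst B X a ha)
  -- (ii) the constant section pushes forward to `0`
  have hMa₀ : M (primeCycle ((ιX B X).base (uXPt B X a₀ ha₀))) = 0 := by
    change AlgebraicCycle.map (CartesianMonoidalCategory.fst X B).left height height _ = _
    rw [algebraicCycleMap_primeCycle_eq_nsmul]
    have h1 : height ((ιX B X).base (uXPt B X a₀ ha₀)) = 1 := by
      let V : ClosedSubvariety (XK B X) := ClosedSubvariety.ofPoint _ (uXPt B X a₀ ha₀)
      have hd := dim_image_eq hP hi hB1 V
      have hV : V.dim = 0 := by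
        change height V.genericPoint = 0
        rw [ClosedSubvariety.genericPoint_ofPoint, ← height_base_eq_of_isClosedImmersion' (iK N B X i),
          iK_uXPt, height_uPt]
      have hI : (V.image (ιX B X)).dim = height ((ιX B X).base (uXPt B X a₀ ha₀)) := by
        change height (V.image (ιX B X)).genericPoint = _
        rw [ClosedSubvariety.genericPoint_image, ClosedSubvariety.genericPoint_ofPoint]
      rw [← hI, hd, hV]
      rfl
    have h0 : height ((CartesianMonoidalCategory.fst X B).left.base
        ((ιX B X).base (uXPt B X a₀ ha₀))) = 0 := by
      rw [fst_ιX_uXPt, ha₀pt, hx₀0]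
    have hne : height ((ιX B X).base (uXPt B X a₀ ha₀)) ≠
        height ((CartesianMonoidalCategory.fst X B).left.base ((ιX B X).base (uXPt B X a₀ ha₀))) := by
      rw [h1, h0]; exact one_ne_zero
    rw [AlgebraicCycle.mapCoeff, if_neg hne, zero_smul]
  -- (iii) vertical parts push forward to cycles supported on lines
  have key_line : ∀ V : AlgebraicCycle (X ⊗ B).left ℤ,
      (∀ z, V z ≠ 0 → IsLinePoint N i ((CartesianMonoidalCategory.fst X B).left.base z)) →
      ∃ s : Finset ↥X.left, (∀ y ∈ s, IsLinePoint N i y) ∧ Function.support (M V) ⊆ s := by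
    intro V hV
    refine ⟨(finite_support_of_compactSpace V).toFinset.image
      (CartesianMonoidalCategory.fst X B).left.base, ?_, ?_⟩
    · intro y hy
      rw [Finset.mem_image] at hy
      obtain ⟨z, hz', rfl⟩ := hy
      exact hV z (Function.mem_support.mp ((Set.Finite.mem_toFinset _).mp hz'))
    · exact support_map_subset _ V _ (by rw [Set.Finite.coe_toFinset])
  -- reduction to a relation `M c' = [z₀] + M V` in `X × B`
  suffices h : ∃ c' ∈ ratTrivial (X ⊗ B).left 1, ∃ V : AlgebraicCycle (X ⊗ B).left ℤ,
      M c' = primeCycle (a.base (IsLocalRing.closedPoint B.left.functionField)) + M V ∧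
        ∀ z, V z ≠ 0 → IsLinePoint N i ((CartesianMonoidalCategory.fst X B).left.base z) by
    obtain ⟨c', hc', V, hMc', hV⟩ := h
    obtain ⟨s, hs, hsupp⟩ := key_line V hV
    refine ⟨s, fun y => -((M V) y), hs, ?_⟩
    change primeCycle _ - ∑ y ∈ s, (-((M V) y)) • primeCycle y ∈ ratTrivial X.left 1
    have hsum : ∑ y ∈ s, (-((M V) y)) • primeCycle y = -(M V) := by
      rw [eq_sum_smul_primeCycle_of_support_subset (-(M V)) (s := s)
        (by rw [Function.locallyFinsuppWithin.coe_neg, Function.support_neg]; exact hsupp)]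
      rfl
    rw [hsum, sub_neg_eq_add, ← hMc']
    exact hMrat c' hc'
  -- the vanishing along the two (or one) lines, and the relations
  have hv0 : ∀ (x y : Fin (N + 1) → B.left.functionField), (![x, y] : Fin 2 → _) 0 = x := fun _ _ => rfl
  have hv1 : ∀ (x y : Fin (N + 1) → B.left.functionField), (![x, y] : Fin 2 → _) 1 = y := fun _ _ => rfl
  -- identification of the lifted points
  have huXa : ∀ uX : ↥(XK B X), (iK N B X i).base uX = (pointOfVec B.left.functionField p hp0).pt →
      uX = uXPt B X a ha := fun uX h => hinjK (by rw [h, hptp, iK_uXPt])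
  have huXa₀ : ∀ uX : ↥(XK B X), (iK N B X i).base uX = (pointOfVec B.left.functionField q hq0).pt →
      uX = uXPt B X a₀ ha₀ := fun uX h => hinjK (by rw [h, hptq, iK_uXPt])
  -- single line through `p`, `q`
  have single : (∀ b (s t : B.left.functionField),
      eval (s • p + t • q) (MvPolynomial.map (algebraMap k B.left.functionField) (F b)) = 0) →
      ∃ c' ∈ ratTrivial (X ⊗ B).left 1, ∃ V : AlgebraicCycle (X ⊗ B).left ℤ,
        M c' = primeCycle (a.base (IsLocalRing.closedPoint B.left.functionField)) + M V ∧
          ∀ z, V z ≠ 0 → IsLinePoint N i ((CartesianMonoidalCategory.fst X B).left.base z) := by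
    intro hFpq
    obtain ⟨c', hc', uX, huX, V, hcV, hV⟩ := exists_relation_of_line B X i hN hB1 hpid F hrange
      ![p, q] hpq (fun b s t => hFpq b s t)
    refine ⟨c', hc', V, ?_, hV⟩
    have h0 : uX 0 = uXPt B X a ha := huXa _ (huX 0)
    have h1 : uX 1 = uXPt B X a₀ ha₀ := huXa₀ _ (huX 1)
    rw [hcV, map_add, map_sub, h0, h1, hMa, hMa₀, sub_zero]
  by_cases hpr : LinearIndependent B.left.functionField ![p, r]
  · by_cases hqr : LinearIndependent B.left.functionField ![q, r]
    · -- two lines `p r` and `q r`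
      obtain ⟨c₁, hc₁, uX₁, huX₁, V₁, hcV₁, hV₁⟩ := exists_relation_of_line B X i hN hB1 hpid F hrange
        ![p, r] hpr (fun b s t => (hr b s t).1)
      obtain ⟨c₂, hc₂, uX₂, huX₂, V₂, hcV₂, hV₂⟩ := exists_relation_of_line B X i hN hB1 hpid F hrange
        ![q, r] hqr (fun b s t => (hr b s t).2)
      refine ⟨c₁ - c₂, sub_mem hc₁ hc₂, V₁ - V₂, ?_, fun z hz' => ?_⟩
      · have h10 : uX₁ 0 = uXPt B X a ha := huXa _ (huX₁ 0)
        have h20 : uX₂ 0 = uXPt B X a₀ ha₀ := huXa₀ _ (huX₂ 0)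
        have h11 : uX₁ 1 = uX₂ 1 := hinjK (by rw [huX₁ 1, huX₂ 1]; exact rfl)
        rw [map_sub, hcV₁, hcV₂, map_add, map_sub, map_add, map_sub, h10, h20, h11, hMa, hMa₀,
          map_sub]
        abel
      · have : V₁ z ≠ 0 ∨ V₂ z ≠ 0 := by
          by_contra hboth
          push Not at hboth
          apply hz'
          rw [Function.locallyFinsuppWithin.coe_sub, Pi.sub_apply, hboth.1, hboth.2, sub_zero]
        rcases this with h | h
        · exact hV₁ z h
        · exact hV₂ z h
    · -- `r` is a multiple of `q`: the single line `p q`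
      obtain ⟨c₀, hc₀, hrq⟩ := exists_eq_smul_of_not_linearIndependent hq0 hr0 hqr
      refine single fun b s t => ?_
      have h := (hr b s (t / c₀)).1
      rwa [hrq, smul_smul, div_mul_cancel₀ t hc₀] at h
  · -- `r` is a multiple of `p`: the single line `p q`
    obtain ⟨c₀, hc₀, hrp⟩ := exists_eq_smul_of_not_linearIndependent hp0 hr0 hpr
    refine single fun b s t => ?_
    have h := (hr b t (s / c₀)).2
    rwa [hrp, smul_smul, div_mul_cancel₀ s hc₀, add_comm (t • q)] at h

end Main

/-! ### The normalization of a curve on `X` -/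

section Normalization

open Literature.AlgebraicGeometry.Resolution

variable (X : SchemeOver k) (z₀ : ↥X.left)

/-- The integral curve `C = closure {z₀} ⊆ X`. [folklore] -/
abbrev curveC : ClosedSubvariety X.left := ClosedSubvariety.ofPoint X.left z₀

/-- **The normalization `B = C^ν` of the curve `C = closure {z₀}`**, as a `k`-scheme via
`C^ν → C ⊆ X → Spec k`. [cite: Liu2002, Def. 4.1.24] -/
def curveB : SchemeOver k :=
  Over.mk (normalizationι (curveC X z₀).carrier ≫ (curveC X z₀).ι ≫ X.hom)

/-- The normalization is integral. [folklore] -/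
instance isIntegral_curveB_left : IsIntegral (curveB X z₀).left :=
  inferInstanceAs (IsIntegral (normalization (curveC X z₀).carrier))

/-- `C^ν → X` over `k`. [folklore] -/
def curveν : curveB X z₀ ⟶ X := Over.homMk (normalizationι (curveC X z₀).carrier ≫ (curveC X z₀).ι) rfl

/-- **The normalization of a curve on a proper `k`-scheme is proper over `k`** (it is finite over
the curve, E. Noether / Liu Cor. 4.1.30). [cite: Liu2002, Cor. 4.1.30] -/
theorem isProper_curveB [IsProper X.hom] : IsProper (curveB X z₀).hom := by
  haveI : IsFinite (normalizationι (curveC X z₀).carrier) :=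
    isFinite_normalizationι _ NoetherFiniteIntegralClosure_holds ((curveC X z₀).ι ≫ X.hom)
  change IsProper (normalizationι (curveC X z₀).carrier ≫ (curveC X z₀).ι ≫ X.hom)
  infer_instance

/-- The generic point `Spec k(C^ν) → C^ν → C ⊆ X`: the generic point of `C` as a `K`-point of
`X`, `K = k(C^ν)`. [folklore] -/
def curveA : Spec (curveB X z₀).left.functionField ⟶ X.left := qgen (curveB X z₀) ≫ (curveν X z₀).left

/-- `curveA` is a `k`-morphism from the generic point of `B = C^ν`. [folklore] -/
theorem curveA_comp_hom : curveA X z₀ ≫ X.hom = qgen (curveB X z₀) ≫ (curveB X z₀).hom := by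
  rw [curveA, Category.assoc, Over.w (curveν X z₀)]

/-- `curveA` hits `z₀`. [folklore] -/
theorem curveA_apply (x : ↥(Spec (curveB X z₀).left.functionField)) : (curveA X z₀).base x = z₀ := by
  have hη : (qgen (curveB X z₀)).base x = _root_.genericPoint (curveB X z₀).left := by
    have h : (qgen (curveB X z₀)).base x ∈ Set.range (qgen (curveB X z₀)).base := ⟨x, rfl⟩
    rwa [range_qgen, Set.mem_singleton_iff] at h
  change (curveC X z₀).ι.base ((normalizationι (curveC X z₀).carrier).base ((qgen (curveB X z₀)).base x)) = z₀
  rw [hη]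
  change (curveC X z₀).ι.base ((normalizationι (curveC X z₀).carrier).base
    (_root_.genericPoint (normalization (curveC X z₀).carrier))) = z₀
  rw [RatFn.genericPoint_eq_of_isDominant (normalizationι (curveC X z₀).carrier)]
  exact ClosedSubvariety.genericPoint_ofPoint z₀

/-- The topological dimension of an integral scheme is the dimension of its generic point.
[folklore] -/
theorem topologicalKrullDim_eq_height_genericPoint (Y : Scheme.{u}) [IsIntegral Y] :
    topologicalKrullDim Y = height (_root_.genericPoint Y) := by
  rw [show topologicalKrullDim Y = krullDim Y from
    Order.krullDim_eq_of_orderIso (irreducibleSetEquivPoints (α := Y))]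
  exact (Order.height_top_eq_krullDim (α := Y)).symm

variable {X z₀}

/-- `dim C = 1` for a point `z₀` of dimension `1`. [folklore] -/
theorem topologicalKrullDim_curveC (hz : height z₀ = 1) :
    topologicalKrullDim ↥(curveC X z₀).carrier = 1 := by
  rw [topologicalKrullDim_eq_height_genericPoint,
    ← height_base_eq_of_isClosedImmersion' (curveC X z₀).ι (_root_.genericPoint _)]
  change ((height (curveC X z₀).genericPoint : ℕ∞) : WithBot ℕ∞) = 1
  rw [ClosedSubvariety.genericPoint_ofPoint, hz]
  rfl

/-- `dim C^ν = 1`. [folklore] -/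
theorem topologicalKrullDim_curveB [LocallyOfFiniteType X.hom] (hz : height z₀ = 1) :
    topologicalKrullDim ↥(curveB X z₀).left = 1 := by
  change topologicalKrullDim ↥(normalization (curveC X z₀).carrier) = 1
  rw [topologicalKrullDim_normalization _ ((curveC X z₀).ι ≫ X.hom), topologicalKrullDim_curveC hz]

/-- The generic point of `C^ν` has dimension `1`. [folklore] -/
theorem height_genericPoint_curveB [LocallyOfFiniteType X.hom] (hz : height z₀ = 1) :
    height (_root_.genericPoint (curveB X z₀).left) = 1 := by
  have h := topologicalKrullDim_curveB hz
  rw [topologicalKrullDim_eq_height_genericPoint] at h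
  exact_mod_cast h

/-- **The local rings of `C^ν` at closed points are principal** (the normalization of a curve is
regular, and a regular local ring of dimension `≤ 1` is a PID). [cite: DeJong1996, 4.3, p. 66] -/
theorem isPrincipalIdealRing_stalk_curveB [LocallyOfFiniteType X.hom] (hz : height z₀ = 1)
    (b : ↥(curveB X z₀).left) : IsPrincipalIdealRing ((curveB X z₀).left.presheaf.stalk b) := by
  have hreg : Scheme.IsRegular (normalization (curveC X z₀).carrier) :=
    isRegular_normalization_of_dim_le_one _ NoetherFiniteIntegralClosure_holds
      ((curveC X z₀).ι ≫ X.hom) (le_of_eq (topologicalKrullDim_curveC hz))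
  haveI : IsRegularLocalRing ((curveB X z₀).left.presheaf.stalk b) := hreg b
  refine isPrincipalIdealRing_of_ringKrullDim_le_one ?_
  rw [AlgebraicGeometry.ringKrullDim_stalk_eq_coheight]
  calc ((coheight b : ℕ∞) : WithBot ℕ∞) ≤ krullDim ↥(curveB X z₀).left := Order.coheight_le_krullDim b
    _ = topologicalKrullDim ↥(curveB X z₀).left :=
      (Order.krullDim_eq_of_orderIso (irreducibleSetEquivPoints (α := ↥(curveB X z₀).left))).symm
    _ ≤ 1 := le_of_eq (topologicalKrullDim_curveB hz)

/-- **`trdeg_k k(C^ν) = 1`.** [cite: GortzWedhorn2020, Thm. 5.22 (3)] -/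
theorem trdeg_curveB [LocallyOfFiniteType X.hom] (hz : height z₀ = 1) :
    Algebra.trdeg k (curveB X z₀).left.functionField = 1 := by
  haveI : LocallyOfFiniteType (curveB X z₀).hom := by
    change LocallyOfFiniteType (normalizationι (curveC X z₀).carrier ≫ (curveC X z₀).ι ≫ X.hom)
    haveI : IsFinite (normalizationι (curveC X z₀).carrier) :=
      isFinite_normalizationι _ NoetherFiniteIntegralClosure_holds ((curveC X z₀).ι ≫ X.hom)
    infer_instance
  have h := height_top_eq_trdeg (curveB X z₀).hom
  have hlt := trdeg_functionField_lt_aleph0 (curveB X z₀).hom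
  have h1 : height (⊤ : ↥(curveB X z₀).left) = 1 := height_genericPoint_curveB hz
  rw [h1] at h
  have h2 : Cardinal.toNat (Algebra.trdeg k (curveB X z₀).left.functionField) = 1 := by
    exact_mod_cast h.symm
  exact Cardinal.toNat_eq_one.mp h2

/-- **`C^ν → C` is birational at the generic point: `κ(z₀) → κ(η_{C^ν})` is onto.** The generic
point of `C^ν` is the image of `Spec k(C) → C^ν` (Mathlib `toNormalization`), through which the
preimmersion `Spec k(C) → C ⊆ X` factors. [folklore] -/
theorem residueFieldMap_curveν_surjective :
    Function.Surjective ((curveν X z₀).left.residueFieldMap (_root_.genericPoint (curveB X z₀).left)) := by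
  let t := (fromSpecFunctionField (curveC X z₀).carrier).toNormalization
  have hcomp : t ≫ (curveν X z₀).left =
      fromSpecFunctionField (curveC X z₀).carrier ≫ (curveC X z₀).ι := by
    change t ≫ (fromSpecFunctionField (curveC X z₀).carrier).fromNormalization ≫ (curveC X z₀).ι = _
    rw [← Category.assoc, Scheme.Hom.toNormalization_fromNormalization]
  have hsurj : Function.Surjective ((curveν X z₀).left.residueFieldMap
      (t.base (IsLocalRing.closedPoint (curveC X z₀).carrier.functionField))) := by
    refine residueFieldMap_surjective_of_comp t _ _ ?_
    rw [hcomp]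
    exact residueFieldMap_surjective_of_isPreimmersion _ _
  haveI : Subsingleton ↥(Spec (curveC X z₀).carrier.functionField) :=
    inferInstanceAs (Subsingleton (PrimeSpectrum (curveC X z₀).carrier.functionField))
  have ht : t.base (IsLocalRing.closedPoint (curveC X z₀).carrier.functionField) =
      _root_.genericPoint (curveB X z₀).left := by
    have h := RatFn.genericPoint_eq_of_isDominant t
    rwa [Subsingleton.elim (_root_.genericPoint ↥(Spec (curveC X z₀).carrier.functionField))
      (IsLocalRing.closedPoint _)] at h
  exact ht ▸ hsurj

/-- **`Spec k(C^ν) → X` has the residue field of `z₀`: `κ(z₀) → k(C^ν)` is onto** (`C^ν → C` is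
birational). [folklore] -/
theorem residueFieldMap_curveA_surjective (x : ↥(Spec (curveB X z₀).left.functionField)) :
    Function.Surjective ((curveA X z₀).residueFieldMap x) := by
  have hν : ∀ y : ↥(curveB X z₀).left, y = _root_.genericPoint (curveB X z₀).left →
      Function.Surjective ((curveν X z₀).left.residueFieldMap y) := by
    rintro y rfl
    exact residueFieldMap_curveν_surjective
  have hη : (qgen (curveB X z₀)).base x = _root_.genericPoint (curveB X z₀).left := by
    have h : (qgen (curveB X z₀)).base x ∈ Set.range (qgen (curveB X z₀)).base := ⟨x, rfl⟩
    rwa [range_qgen, Set.mem_singleton_iff] at h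
  rw [curveA, Scheme.residueFieldMap_comp]
  intro r
  obtain ⟨s, rfl⟩ := residueFieldMap_surjective_of_isPreimmersion (qgen (curveB X z₀)) x r
  obtain ⟨u, rfl⟩ := hν _ hη s
  exact ⟨u, rfl⟩

end Normalization

end ProjFamily

/-! ### Tian–Zong, Prop. 7.2 for smooth complete intersections with `Σ dᵢ² ≤ n + c` -/

/-- **Lines generate `CH₁` when `Σ d_a² ≤ n + c`** (Tian–Zong 2014, Prop. 7.2, by the product
trick, for smooth complete intersections): the named fact
`TianZong2014_chowOne_generatedByLines` under the extra hypothesis `Σ_a d_a² ≤ n + c`. For every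
integral curve `C ⊆ X` apply `ProjFamily.exists_lines_of_birational_curve` to the normalization
`B = C^ν` (`trdeg_k k(B) = 1`, principal local rings, `Spec k(B) → X` birational onto `C`), and
conclude with `ChowOneGeneratedByLines.of_primeCycle` (`Motives/LinesGenerateChowOneProofs`).
[cite: TianZong2014, Prop. 7.2] -/
theorem TianZong2014_chowOne_generatedByLines_of_sum_sq_le
    ⦃k : Type u⦄ [Field k] [IsAlgClosed k] [CharZero k] ⦃c : ℕ⦄ (n : ℕ) (d : Fin c → ℕ)
    ⦃X : SchemeOver k⦄ (F : Fin c → MvPolynomial (Fin (n + c + 1)) k)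
    (i : X ⟶ projectiveSpace (n + c) k) (hX : IsSmoothProjective n X)
    (hF : ∀ a, (F a).IsHomogeneous (d a)) (hd : ∀ a, 0 < d a) (hi : IsClosedImmersion i.left)
    (hV : Set.range i.left.base =
      ProjectiveSpectrum.zeroLocus (MvPolynomial.homogeneousSubmodule (Fin (n + c + 1)) k)
        (Set.range F))
    (hdeg : (∑ a, d a) + 1 ≤ n + c) (hsq : ∑ a, d a ^ 2 ≤ n + c) :
    ChowOneGeneratedByLines (n + c) i := by
  haveI := hi
  haveI : CompactSpace ↥X.left := IsSmoothProjective.compactSpace_holds hX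
  haveI : IsProper (projectiveSpace (n + c) k).hom := isProper_projectiveSpace (n + c) k
  haveI : IsProper X.hom := by rw [← Over.w i]; infer_instance
  refine ChowOneGeneratedByLines.of_primeCycle fun z hz => ?_
  haveI := ProjFamily.isProper_curveB X z
  have h := ProjFamily.exists_lines_of_birational_curve (ProjFamily.curveB X z) X i (by omega)
    (ProjFamily.height_genericPoint_curveB hz)
    (fun b _ => ProjFamily.isPrincipalIdealRing_stalk_curveB hz b) (ProjFamily.trdeg_curveB hz)
    F d hF hd hV hsq (ProjFamily.curveA X z) (ProjFamily.curveA_comp_hom X z)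
    (by rw [ProjFamily.curveA_apply]; exact hz) (ProjFamily.residueFieldMap_curveA_surjective _)
  rwa [ProjFamily.curveA_apply] at h





end Literature.AlgebraicGeometry.Motives

end
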